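import Summits.QuantumFields.BalabanUV.T4Continuum.Support.B13StepEndArithmetic

/-!
# NE5 ∕ U3 — NON-VACUITY ON THE CARRIERS OF RECORD of the END faces' ENTIRE displayed binder list: the ZERO slot package
# on any `R : B13Carriers.TwoRuns 𝔾` discharges every hypothesis of `B13StepEndArithmetic.exists_ne5_of_record` (hence of
# `B13StepEnd.ne5_of_assembly` at `B13StepOfRecord.assembly`, up to the eliminated letters) in the kernel
# (row O6-n follower; claim table `t4/b2b-balaban-t4-ne5-p1/O1-CLAIM-TABLE-NE5-P1.md`; typer `t4/formal/NE5/DAG.md` END face E1)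

Cell `pub-balaban`, unit `b2b-balaban-t4-ne5-formalise-leaf-10-g3` (NE5 formalisation swarm, LEAF PROVER 10, gen 3; lineage modules
`OutputRateArithmetic` p207722, `B13StepEndInsOp` p209302, `B13StepEndArithmetic` p210647).  Summits-side new work under the LEAN
PLACEMENT RULE (cell bookkeeping; NOT a Literature module); imports `B13StepEndArithmetic` BY NAME and edits nothing.  HONEST FRAMING:
rung (B)+1 of the FINITE-VOLUME T⁴ continuum programme — NOT infinite volume, NOT a mass gap, NOT the Clay problem, and **NOT A PROOF
OF NE5** and NOT a statement about [Balaban1988RG2Cluster]'s kernels, potentials or (2.14)-terms: the slot package below is the ZERO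
package (every activity term, raw species and insertion operator `0`), a CONSISTENCY WITNESS only.  HONEST DEPENDENCY (cell line,
verbatim): continuum YM on T⁴ ⇐ BetaPertH ∧ nine spine estimates (0/9 proved); BetaPertH ⇐ (D1) ∧ (D4) ∧ CAP+tail; G-an2-4 gates
asym, D1 and NE2/3/4.

WHY.  The END faces of record (`B13StepEnd.ne5_of_assembly`, `B13StepEndInsOp.ne5_of_record_insOp`, `B13StepEndArithmetic.*`)
are IMPLICATIONS from some fifteen displayed hypotheses (reading, two one-run slice budgets, two one-run levels, two raw-boundedness
clauses, row NE2's entry rate, margin floor, W4, three termwise W2 clauses, two room clauses) plus signs and the two strict size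
inequalities.  An implication from jointly UNSATISFIABLE hypotheses would be vacuous; the existing witnesses are on TOY carriers
(`B13TermRepWitness`, `B13HistWitness`, `B13BaseWitness`, `OutputRateInsertionWitness`) or for route P2's three leaves
(`B13ActivityRouteNumerics.leaves_b13_witness`).  This file closes that gap for route P1's END on Bałaban's paired-torus carriers:
* §1 `zeroInsDatum C` (row O1-c's `InsDatum` with `base = slice = insOpA = insOpB = 0`, `ω = ½`), `unitFormat`, `zeroSlots R`
  (row O1-e's `Slots` with `act = 0`, `rawA = rawB = 0`, margins `1`); generic lemmas `term_zero_act`∕`out_zero_act` (the Ursell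
  series of zero activities is `0`) and `recA_eq_zero_of_out`∕`recB_eq_zero_of_out` (a step model with zero output functional has
  zero recursive outputs — `StepRecursion.recA∕recB` unfolded);
* §2 EVERY displayed binder of `exists_ne5_of_record` for `zeroSlots R`, one theorem each: `transportReads_zero`, `sliceBudgetB_zero`,
  `sliceBudget_zero`, `decayBound_outA_zero`∕`decayBound_outB_zero` (levels `EA₀ = E₀ = 0`), `rawBounded_zero` ×2,
  `weightedEntrywiseRate_zero` (`c₁ = 0`, any rate), `insertionRate_zero` (`δ′ = 0`), `termBound_zero` (`a = 0`), `termBudget_zero`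
  (`G = 0`), `termLineAnalytic_zero`, room by `le_rfl`; and for the W4-produced face the insertion-operator species of the zero datum
  (margin `rI = 1`): `insOpRate_zero` (`δI = 0`), `insOpEnvelope_zero`∕`insBoundA_zero` (`Gi = 0`; `ins_zero`: the zero datum's
  insertion functional vanishes at every insertion-operator datum);
* §3 **`end_fires_zeroSlots`**: `∃ C₅, NE5 (outA (zeroSlots R) 0 0) (outB (zeroSlots R) 0 0) W κ 1 C₅` obtained THROUGH
  `B13StepEndArithmetic.exists_ne5_of_record` with every hypothesis discharged by §2 and the sizes
  `(cA, cB, EA₀, E₀, G, c₁, r₀, δ′, θ, θ′, ω) = (0, 0, 0, 0, 0, 0, 1, 0, ½, 1, ½)` (the two strict size inequalities read `0·(0+0) < 1 − ½`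
  and `½ + 0 < 1`), for EVERY `R`, window `W` and decay rate `κ` — the binder list is JOINTLY INHABITED on the carriers of record; and
  `end_fires_zeroSlots_insOp` (the W4-PRODUCED END `exists_ne5_of_record_insOp` with the insertion species' envelope ∕ bound ∕ rate at
  `(Gi, δI, rI) = (0, 0, 1)`); **`uniform_end_fires_zero`**: the UNIFORM face `uniform_ne5_of_record` instantiated at the same sizes and
  applied to `zeroSlots R`.
Nothing of the manuscripts under audit is asserted; 0 sorry; no new axioms.
-/

noncomputable section

open Metric Set
open scoped BigOperators

namespace Summit.QuantumFields.BalabanUV.T4Continuum.B13StepEndWitness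

open Literature.MathematicalPhysics.QuantumFieldTheory.Balaban1983to89
open Literature.MathematicalPhysics.QuantumFieldTheory.Balaban1983to89.T4OutputRate (Carriers Functional DecayBound NE5)
open Literature.MathematicalPhysics.QuantumFieldTheory.Balaban1983to89.T4InputCauchyRateData (StepModel)
open Literature.MathematicalPhysics.QuantumFieldTheory.Balaban1983to89.T4InputCauchyRateSpecies (ballClass)
open Literature.MathematicalPhysics.QuantumFieldTheory.Balaban1983to89.T4InputCauchyRateTermwise
  (TermBound TermBudget TermLineAnalytic)
open Summit.QuantumFields.BalabanUV.T4Continuum.B13Carriers (TwoRuns)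
open Summit.QuantumFields.BalabanUV.T4Continuum.B13OpDatum (Format OpDatum InFormat FormatBounded)
open Summit.QuantumFields.BalabanUV.T4Continuum.B13OpDatumJunctions (RawBounded WeightedEntrywiseRate)
open Summit.QuantumFields.BalabanUV.T4Continuum.B13HistInsertion (InsDatum)
open Summit.QuantumFields.BalabanUV.T4Continuum.B13StepTermLabels (TermIdx InnerLabel)
open Summit.QuantumFields.BalabanUV.T4Continuum.B13StepTermFamily (TermIndexing term out)
open Summit.QuantumFields.BalabanUV.T4Continuum.B13InnerData (Bnd)
open Summit.QuantumFields.BalabanUV.T4Continuum.B13Base (selfCtr)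
open Summit.QuantumFields.BalabanUV.T4Continuum.B13Represents (Assembly)
open Summit.QuantumFields.BalabanUV.T4Continuum.B13StepOfRecord (Slots assembly step outA outB)
open Summit.QuantumFields.BalabanUV.T4Continuum.StepRecursion (recA recB recTableA causalFix stepMapA stepMapB)
open Summit.QuantumFields.BalabanUV.T4Continuum.B13StepEndArithmetic (exists_ne5_of_record uniform_ne5_of_record)

/-! ## §1 The zero package and two generic vanishing lemmas -/

section Generic

variable {C : Carriers} {ι P J Op Hist : Type*} (𝒯 : TermIndexing C ι P J) (inc : P → P → Prop) [DecidableRel inc]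

/-- [folklore] The Ursell term of the ZERO activity family vanishes (a product over `n + 1 ≥ 1` zero factors). -/
theorem term_zero_act (k : ℕ) (i : ι) (o : Op) (h : Hist) (X : C.Dom) :
    term 𝒯 inc (fun (_ : P) (_ : J) (_ : Op) (_ : Hist) => (0 : ℂ)) k i o h X = 0 := by
  rw [term]
  split_ifs
  · rw [Finset.prod_eq_zero (Finset.mem_univ (0 : Fin (𝒯.len i + 1))) rfl, mul_zero]
  · rfl

/-- [folklore] The output functional (2.13) of the zero activity family vanishes. -/
theorem out_zero_act (k : ℕ) (o : Op) (h : Hist) (X : C.Dom) :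
    out 𝒯 inc (fun (_ : P) (_ : J) (_ : Op) (_ : Hist) => (0 : ℂ)) k o h X = 0 := by
  simp only [out, term_zero_act, tsum_zero]

variable [NormedAddCommGroup Op] [NormedSpace ℂ Op] [NormedAddCommGroup Hist] [NormedSpace ℂ Hist] {M : StepModel C Op Hist}

/-- [folklore] A step model with ZERO output functional has zero recursive run-B output (`StepRecursion.recB` unfolded: the last
application of the step map reads `Out`). -/
theorem recB_eq_zero_of_out (hOut : ∀ k o h X, M.Out k o h X = 0) (g : ℕ → ℝ) (U : C.BgB) (X : C.Dom) :
    recB M g U X = 0 := by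
  show causalFix C.scale (stepMapB M g U) X = 0
  simp only [causalFix, Function.iterate_succ_apply', stepMapB, hOut, Complex.zero_re]

/-- [folklore] … and zero recursive run-A output (at transported backgrounds by the recursion, elsewhere by the junk value). -/
theorem recA_eq_zero_of_out (hOut : ∀ k o h X, M.Out k o h X = 0) (g : ℕ → ℝ) (V : C.BgA) (X : C.Dom) :
    recA M g V X = 0 := by
  unfold recA
  split_ifs with h
  · show causalFix C.scale (stepMapA M g (Classical.choose h)) X = 0
    simp only [causalFix, Function.iterate_succ_apply', stepMapA, hOut, Complex.zero_re]
  · rfl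

end Generic

/-- [folklore] DATA: the one-entry format with weight `1`. -/
def unitFormat : Format Unit where
  wt := fun _ => 1
  wt_pos := fun _ => one_pos

/-- [folklore] DATA: the ZERO insertion datum (row O1-c's `InsDatum` with every field `0`, age damping `ω = ½`). -/
def zeroInsDatum (C : Carriers) : InsDatum C ℂ ℂ where
  base := fun _ _ => 0
  slice := fun _ _ _ _ => 0
  slice_add := fun _ _ _ _ _ => by simp
  slice_smul := fun _ _ _ _ _ => by simp
  slice_local := fun _ _ _ _ _ _ => rfl
  ω := 1 / 2
  insOpA := fun _ _ _ => 0
  insOpB := fun _ _ _ => 0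

variable {𝔾 : Type} [GaugeGroup 𝔾]

/-- [folklore] DATA: **THE ZERO SLOT PACKAGE** on the carriers of record — activity terms `0`, unit format, raw species `0`, the zero
insertion datum, margins `1`. -/
def zeroSlots (R : TwoRuns 𝔾) : Slots R Unit ℂ ℂ where
  act := fun _ _ _ _ => 0
  F := fun _ => unitFormat
  rawA := fun _ _ _ _ => 0
  rawB := fun _ _ _ _ => 0
  D := zeroInsDatum R.carriers
  rOp := fun _ => 1
  rHist := fun _ => 1
  rOp_pos := fun _ => one_pos
  rHist_pos := fun _ => one_pos

variable (R : TwoRuns 𝔾) (E₀ cB : ℝ)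

/-- [folklore] The model of record of the zero package has zero output functional. -/
theorem step_out_zero (k : ℕ) (o : OpDatum Unit) (h : ℂ) (X : R.carriers.Dom) : (step (zeroSlots R) E₀ cB).Out k o h X = 0 :=
  out_zero_act _ _ k o h X

/-- [folklore] Its recursive outputs vanish: run A … -/
theorem outA_zero (g : ℕ → ℝ) (V : R.carriers.BgA) (X : R.carriers.Dom) : outA (zeroSlots R) E₀ cB g V X = 0 :=
  recA_eq_zero_of_out (step_out_zero R E₀ cB) g V X

/-- [folklore] … and run B. -/
theorem outB_zero (g : ℕ → ℝ) (U : R.carriers.BgB) (X : R.carriers.Dom) : outB (zeroSlots R) E₀ cB g U X = 0 :=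
  recB_eq_zero_of_out (step_out_zero R E₀ cB) g U X

/-- [folklore] Its insertion maps vanish (run A). -/
theorem insA_zero (g : ℕ → ℝ) (U : R.carriers.BgB) (k : ℕ) (t : R.carriers.Dom → ℝ) :
    (step (zeroSlots R) E₀ cB).insA g U k t = 0 := by
  show (zeroInsDatum R.carriers).insA g U k t = 0
  simp [InsDatum.insA, InsDatum.ins, zeroInsDatum]

/-- [folklore] Its insertion maps vanish (run B). -/
theorem insB_zero (g : ℕ → ℝ) (U : R.carriers.BgB) (k : ℕ) (t : R.carriers.Dom → ℝ) :
    (step (zeroSlots R) E₀ cB).insB g U k t = 0 := by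
  show (zeroInsDatum R.carriers).insB g U k t = 0
  simp [InsDatum.insB, InsDatum.ins, zeroInsDatum]

/-- [folklore] The zero datum's insertion functional vanishes at EVERY insertion-operator datum (not only the runs' own). -/
theorem ins_zero (k : ℕ) (a : ℂ) (t : R.carriers.Dom → ℝ) : (zeroInsDatum R.carriers).ins k a t = 0 := by
  simp [InsDatum.ins, zeroInsDatum]

/-- [folklore] Its Ursell terms vanish. -/
theorem term_zero (k : ℕ) (i : TermIdx R.carriers.Dom (Bnd R)) (o : OpDatum Unit) (h : ℂ) (X : R.carriers.Dom) :
    term (assembly (zeroSlots R)).𝒯 (assembly (zeroSlots R)).inc (zeroSlots R).act k i o h X = 0 :=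
  term_zero_act _ _ k i o h X

/-! ## §2 Every displayed binder of the END, for the zero package -/

variable (W : Set (ℕ → ℝ)) (κ : ℝ)

/-- [folklore] READING `TransportReads`: run A's (zero) insertion-operator data are read at the transported background. -/
theorem transportReads_zero : (assembly (zeroSlots R)).TransportReads W :=
  Assembly.transportReads_of_insOpAt _ (insOpA' := fun _ _ _ => (0 : ℂ)) (fun _ _ _ => rfl) W

/-- [folklore] W3-KIND, run B: the slice budget with constant `0`. -/
theorem sliceBudgetB_zero : (assembly (zeroSlots R)).SliceBudgetB W κ 0 := by
  intro k g _ U j T t _ _ _ _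
  show ‖(0 : ℂ)‖ ≤ 1 * (0 * T)
  simp

/-- [folklore] W3-KIND, run A: the slice budget with constant `0`. -/
theorem sliceBudget_zero : (zeroSlots R).D.SliceBudget (step (zeroSlots R) E₀ cB) W κ 0 := by
  intro k g _ U j T t _ _ _ _
  show ‖(0 : ℂ)‖ ≤ 1 * (0 * T)
  simp

/-- [folklore] L05 SHAPE at level `0`: the (zero) run-A output obeys `DecayBound … W 0 κ`. -/
theorem decayBound_outA_zero : DecayBound (outA (zeroSlots R) E₀ cB) W 0 κ := by
  intro g _ V X
  rw [outA_zero, abs_zero, zero_mul]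

/-- [folklore] L06 SHAPE at level `0`: the (zero) run-B output obeys `DecayBound … W 0 κ`. -/
theorem decayBound_outB_zero : DecayBound (outB (zeroSlots R) E₀ cB) W 0 κ := by
  intro g _ U X
  rw [outB_zero, abs_zero, zero_mul]

/-- [folklore] Raw boundedness, run A at the transported background. -/
theorem rawBounded_rawAt_zero : RawBounded (zeroSlots R).F (assembly (zeroSlots R)).rawAt W :=
  fun _ _ _ _ => ⟨0, fun _ => by simp [Assembly.rawAt, assembly, zeroSlots]⟩

/-- [folklore] Raw boundedness, run B. -/
theorem rawBounded_rawB_zero : RawBounded (zeroSlots R).F (zeroSlots R).rawB W :=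
  fun _ _ _ _ => ⟨0, fun _ => by simp [zeroSlots]⟩

/-- [folklore] Row NE2's entry-currency rate SHAPE with constant `0`, at any rate sequence. -/
theorem weightedEntrywiseRate_zero (rate : ℕ → ℝ) :
    WeightedEntrywiseRate (zeroSlots R).F (assembly (zeroSlots R)).rawAt (zeroSlots R).rawB W 0 rate := by
  intro k g _ U e
  show ‖(0 : ℂ) - 0‖ ≤ 0 * rate k * 1
  simp

/-- [folklore] The margin floor `1 ≤ rOp k`. -/
theorem floor_zero (k : ℕ) : (1 : ℝ) ≤ (zeroSlots R).rOp k := le_rfl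

/-- [folklore] W4 SHAPE with constant `0`: the two (zero) insertion maps agree. -/
theorem insertionRate_zero (θ : ℝ) : (step (zeroSlots R) E₀ cB).InsertionRate W κ E₀ 0 θ := by
  intro k g _ U t _
  rw [insA_zero, insB_zero, sub_zero, norm_zero, zero_mul, zero_mul]

/-- [folklore] W2, termwise bound with weights `0` on ANY class. -/
theorem termBound_zero (K : ℕ → (ℕ → ℝ) → R.carriers.BgB → Set (OpDatum Unit × ℂ)) :
    TermBound K (term (assembly (zeroSlots R)).𝒯 (assembly (zeroSlots R)).inc (zeroSlots R).act) W κ (fun _ _ => 0) := by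
  intro k g _ U q _ X _ i
  rw [term_zero, norm_zero, zero_mul]

/-- [folklore] W2, budget: the zero weights are summable with sum `≤ 0`. -/
theorem termBudget_zero : TermBudget (ι := TermIdx R.carriers.Dom (Bnd R)) (fun _ _ => (0 : ℝ)) 0 :=
  fun _ => ⟨summable_zero, by simp⟩

/-- [folklore] W2, line analyticity: the zero terms are complex differentiable along every segment of ANY class. -/
theorem termLineAnalytic_zero (K : ℕ → (ℕ → ℝ) → R.carriers.BgB → Set (OpDatum Unit × ℂ)) :
    TermLineAnalytic K (term (assembly (zeroSlots R)).𝒯 (assembly (zeroSlots R)).inc (zeroSlots R).act) W := by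
  intro k g _ U o u h v _ X _ i
  simp only [term_zero]
  exact differentiableOn_const 0

/-- [folklore] The age damping of the zero package is `½`. -/
theorem omega_zero : (zeroSlots R).D.ω = 1 / 2 := rfl

/-- [folklore] The insertion-operator SPECIES of the zero datum (margin `rI = 1`): its two-run rate with constant `0`. -/
theorem insOpRate_zero (θ : ℝ) :
    ((zeroSlots R).D.toInsOpModel (step (zeroSlots R) E₀ cB) (fun _ => 1) (fun _ => one_pos)).InsOpRate W 0 θ := by
  intro k g _ U
  show ‖(0 : ℂ) - 0‖ ≤ 0 * θ ^ k * 1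
  simp

/-- [folklore] … its one-run envelope with level `0` (the zero functional is differentiable along every operator line). -/
theorem insOpEnvelope_zero :
    ((zeroSlots R).D.toInsOpModel (step (zeroSlots R) E₀ cB) (fun _ => 1) (fun _ => one_pos)).InsOpEnvelope W κ E₀ 0 := by
  intro k g _ U t _ u _
  refine ⟨?_, fun ζ _ => ?_⟩
  · show DifferentiableOn ℂ (fun ζ : ℂ => (zeroInsDatum R.carriers).ins k (0 + ζ • u) t) (closedBall 0 1)
    simp only [ins_zero]
    exact differentiableOn_const 0
  · show ‖(zeroInsDatum R.carriers).ins k (0 + ζ • u) t‖ ≤ 0 * (1 : ℝ)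
    rw [ins_zero, norm_zero, zero_mul]

/-- [folklore] … and its one-run bound for run A with level `0`. -/
theorem insBoundA_zero :
    ((zeroSlots R).D.toInsOpModel (step (zeroSlots R) E₀ cB) (fun _ => 1) (fun _ => one_pos)).InsBoundA W κ E₀ 0 := by
  intro k g _ U t _
  show ‖(zeroInsDatum R.carriers).ins k 0 t‖ ≤ 0 * (1 : ℝ)
  rw [ins_zero, norm_zero, zero_mul]

/-! ## §3 The END fires for the zero package: the binder list is jointly inhabited on the carriers of record -/

/-- [folklore] **NON-VACUITY OF THE END ON BAŁABAN's CARRIERS OF RECORD.**  For EVERY pair of runs `R : TwoRuns 𝔾`, every window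
`W` and every decay rate `κ`: the zero slot package satisfies EVERY hypothesis of `B13StepEndArithmetic.exists_ne5_of_record` — the
reading, both one-run slice budgets (constants `0`), both one-run levels (`0`), raw boundedness ×2, row NE2's entry rate (constant `0`,
rate `(½)^k`), the floor (`r₀ = 1`), W4 (`δ′ = 0`), the three termwise W2 clauses (weights `0`, budget `0`) on the roomy class with
`ROp = rOp`, `RHist = bHist + rHist`, the signs, and the two strict size inequalities (`0·(0+0) < 1 − ½`, `½ + 0 < 1`) — so the END
FIRES: `∃ C₅, NE5 (outA …) (outB …) W κ 1 C₅`.  The displayed binder list of the END faces of record is therefore JOINTLY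
SATISFIABLE (no hidden sign ∕ shape clash).  A consistency witness; nothing about [II]'s objects. -/
theorem end_fires_zeroSlots : ∃ C₅, NE5 (outA (zeroSlots R) 0 0) (outB (zeroSlots R) 0 0) W κ 1 C₅ :=
  exists_ne5_of_record (zeroSlots R) 0 0 (EA₀ := 0) (G := 0) (cA := 0) (c₁ := 0) (r₀ := 1) (δ' := 0) (θ := 1 / 2)
    (ROp := (zeroSlots R).rOp) (RHist := fun k => (assembly (zeroSlots R)).bHist 0 0 k + (zeroSlots R).rHist k)
    (transportReads_zero R W) (sliceBudgetB_zero R W κ) (sliceBudget_zero R 0 0 W κ) (decayBound_outA_zero R 0 0 W κ)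
    (decayBound_outB_zero R 0 0 W κ) (rawBounded_rawAt_zero R W) (rawBounded_rawB_zero R W)
    (weightedEntrywiseRate_zero R W fun k => (1 / 2 : ℝ) ^ k) (floor_zero R) (insertionRate_zero R 0 0 W κ (1 / 2))
    (termBound_zero R W κ _) (termBudget_zero R) (termLineAnalytic_zero R W _) (fun _ => le_rfl) (fun _ => le_rfl)
    le_rfl le_rfl le_rfl le_rfl le_rfl one_pos le_rfl (by norm_num) (by norm_num) (by norm_num) le_rfl
    (by rw [omega_zero]; norm_num) (by rw [omega_zero]; norm_num) (by rw [omega_zero]; norm_num) (by rw [omega_zero]; norm_num)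

/-- [folklore] **THE W4-PRODUCED END IS INHABITED TOO**: `B13StepEndArithmetic.exists_ne5_of_record_insOp` fires for the zero
package with the insertion-operator species' envelope ∕ bound ∕ rate at `(Gi, δI, rI) = (0, 0, 1)` in place of W4. -/
theorem end_fires_zeroSlots_insOp : ∃ C₅, NE5 (outA (zeroSlots R) 0 0) (outB (zeroSlots R) 0 0) W κ 1 C₅ :=
  B13StepEndArithmetic.exists_ne5_of_record_insOp (zeroSlots R) 0 0 (EA₀ := 0) (G := 0) (cA := 0) (c₁ := 0) (r₀ := 1) (Gi := 0)
    (δI := 0) (θ := 1 / 2) (ROp := (zeroSlots R).rOp) (RHist := fun k => (assembly (zeroSlots R)).bHist 0 0 k + (zeroSlots R).rHist k)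
    (fun _ => 1) (fun _ => one_pos)
    (transportReads_zero R W) (sliceBudgetB_zero R W κ) (sliceBudget_zero R 0 0 W κ) (decayBound_outA_zero R 0 0 W κ)
    (decayBound_outB_zero R 0 0 W κ) (rawBounded_rawAt_zero R W) (rawBounded_rawB_zero R W)
    (weightedEntrywiseRate_zero R W fun k => (1 / 2 : ℝ) ^ k) (floor_zero R) (insOpEnvelope_zero R 0 0 W κ)
    (insBoundA_zero R 0 0 W κ) (insOpRate_zero R 0 0 W (1 / 2)) le_rfl le_rfl
    (termBound_zero R W κ _) (termBudget_zero R) (termLineAnalytic_zero R W _) (fun _ => le_rfl) (fun _ => le_rfl)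
    le_rfl le_rfl le_rfl le_rfl le_rfl one_pos (by norm_num) (by norm_num) (by norm_num) le_rfl
    (by rw [omega_zero]; norm_num) (by rw [omega_zero]; norm_num) (by rw [omega_zero]; norm_num) (by rw [omega_zero]; norm_num)

/-- [folklore] **THE UNIFORM FACE IS INHABITED TOO**: `uniform_ne5_of_record` at the sizes `(κ, G, EA₀, E₀, cA, cB, c₁, r₀, δ′, θ, θ′, ω)
= (κ, 0, 0, 0, 0, 0, 0, 1, 0, ½, 1, ½)` yields one constant `C₅` which, applied to the zero package on ANY pair of runs (age damping
`½ = ω` by `rfl`), gives `NE5 (outA (zeroSlots R) 0 0) (outB (zeroSlots R) 0 0) W κ 1 C₅` — the same `C₅` for every `R` and `W`. -/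
theorem uniform_end_fires_zero :
    ∃ C₅, ∀ (R : TwoRuns 𝔾) (W : Set (ℕ → ℝ)), NE5 (outA (zeroSlots R) 0 0) (outB (zeroSlots R) 0 0) W κ 1 C₅ := by
  obtain ⟨C₅, hC⟩ := uniform_ne5_of_record (κ := κ) (G := 0) (EA₀ := 0) (E₀ := 0) (cA := 0) (cB := 0) (c₁ := 0) (r₀ := 1)
    (δ' := 0) (θ := 1 / 2) (θ' := 1) (ω := 1 / 2) le_rfl le_rfl le_rfl le_rfl le_rfl one_pos le_rfl (by norm_num) (by norm_num)
    (by norm_num) le_rfl (by norm_num) (by norm_num) (by norm_num) (by norm_num)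
  refine ⟨C₅, fun R W => ?_⟩
  exact hC (zeroSlots R) (omega_zero R) (transportReads_zero R W) (sliceBudgetB_zero R W κ) (sliceBudget_zero R 0 0 W κ)
    (decayBound_outA_zero R 0 0 W κ) (decayBound_outB_zero R 0 0 W κ) (rawBounded_rawAt_zero R W) (rawBounded_rawB_zero R W)
    (weightedEntrywiseRate_zero R W fun k => (1 / 2 : ℝ) ^ k) (floor_zero R) (insertionRate_zero R 0 0 W κ (1 / 2))
    (termBound_zero R W κ _) (termBudget_zero R) (termLineAnalytic_zero R W _) (fun _ => le_rfl) (fun _ => le_rfl)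

end Summit.QuantumFields.BalabanUV.T4Continuum.B13StepEndWitness

end
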